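import Summits.QuantumFields.BalabanUV.Beta.FP.RoadEndGeneric
import Summits.QuantumFields.BalabanUV.Beta.FP.FixedPointIdentificationSummable

/-!
# `BalabanUV.Beta.FP.RoadEndPowdev` — road «FP» for binder row D1, PROPOSED RULING R-FP-47 door (ii) «GHOST-RG», END v2′ link 2 (owner, gen 15):
# THE DRESSING-AGNOSTIC END OF ROAD FP WITH THE (STEP) BINDER WEAKENED TO A BOUNDED DEVIATION FROM THE POWER LAW —
# `|fPerfG (m) − m·fPerfG 1| ≤ D` (e.g. from a variable-defect step law with Σ-bounded defects) + (CONV-C) rows + (ASYMP) ⊢ `D1Drift Lc Js N μ ν`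

HONEST DEPENDENCY (page 1, mandatory): continuum YM on T⁴ ⇐ BetaPertH ∧ nine spine estimates (0/9 proved); BetaPertH ⇐ (D1) ∧ (D4) ∧ CAP+tail;
G-an2-4 gates asym, D1 and NE2/3/4.  HONEST FRAMING (cell contract, verbatim): «discharging `BetaPertH` makes Bałaban's UV stability UNCONDITIONAL —
a real constructive-QFT result; it is NOT the continuum limit and NOT the Clay problem.»  THIS MODULE is [our object] COMPOSITION BY NAME: the owner's gen-3
`RoadEndGeneric.d1Drift_of_generic_step_law_bounded` ∕ `_of_self_…` with the step-law binder `hstep` replaced by the bounded-deviation binder `hdev` (value lemma =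
`FixedPointIdentification.eq_of_nat_mul_sub_bounded`; asym1's `HessKerFourFamily.d1Drift_iff_of_cauchy_four` unchanged).  No `def`, no `def … : Prop`, nothing
cited, 0 sorry; 0∕4 row-D1 binders — every binder is a HYPOTHESIS shape; NOT (CONV-C), NOT SDF, NOT (ASYMP), NOT D1, NOT BetaPertH, NOT continuum, NOT Clay.

ABSOLUTE RULE (cell charter, verbatim): «No internally-minted statement may enter as a cited fact. Every hypothesis is either kernel-proved in this package or a
verbatim quotation of a PUBLISHED theorem with page reference. The manuscript(s) under audit are NOT citable for their own disputed steps — they are the thing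
under adjudication; programme-internal (2001/route/tribunal) claims are never citable.»

WHY (E-FP-15-2 ∕ PROPOSED R-FP-47, journal l.34659; `FP/FixedPointIdentificationSummable` ✓).  For the covariant literal the gluon-only one-loop kernels do NOT obey
the step law exactly (the typed gauge rows' Faddeev–Popov step defect, `GhostAwareStepLawHessian` ✓); door (ii) «GHOST-RG» replaces the exact (STEP) ∕ `hSDF` binder by
«the step defects have bounded partial sums», which is equivalent to the bounded deviation `|f (Lc^m) − m·f Lc| ≤ D` (`FixedPointIdentificationSummable.
stepLaw_sum_bounded_of_summableDefect`).  This file threads that binder through the END BY TYPE; the left-placed ENDs (`RoadEndLeft`, `RoadLeftAssembly*`)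
take their twins from here (swarm rows END-v2′-3…).

CONTENTS: `value_eq_of_powdev_bounded'` (`m`-indexed value lemma), **`d1Drift_of_generic_powdev_bounded`**, **`d1Drift_of_self_powdev_bounded`**,
**`d1Drift_of_self_summableDefect_bounded`**.
Provenance: road FP OWNER b2b-balaban-beta-d1-p3 gen 15 (prover-b2b-balaban-beta-d1-p3-g15-0), 2026-08-21; R-FP-47 door (ii); new file, nothing appended to others' modules.
-/

noncomputable section

namespace Summit.QuantumFields.BalabanUV.Beta.FP.RoadEndPowdev

open Filter Topology Finset
open Literature.MathematicalPhysics.QuantumFieldTheory.Balaban1983to89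
open Literature.MathematicalPhysics.QuantumFieldTheory.Balaban1983to89.Beta
open ExpKernelCalculus (MKer Decays VertexFamily₂ hessKer)
open OneStepResolventKernel (Fib LocStencil JetData)
open OneStepKernelFamily (vertexOfK KInvStep TbalOf D1Drift)
open B12Normalization (stepBal)
open Summit.QuantumFields.BalabanUV.Beta.HessKerDressedUnits (unitK unitS unitW)
open Summit.QuantumFields.BalabanUV.Beta.HessKerFourFamily (d1Drift_iff_of_cauchy_four TbalOf_apply)
open Summit.QuantumFields.BalabanUV.Beta.FixedPointIdentification (eq_of_nat_mul_sub_bounded)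
open Summit.QuantumFields.BalabanUV.Beta.FP.RoadEndGeneric (fPerfG fPerfG_one closedForm_unit)
open Summit.QuantumFields.BalabanUV.Beta.FP.FixedPointIdentificationSummable (closed_form_of_variableDefect_step_law)

/-! ## §1 The `m`-indexed value lemma with a bounded deviation -/

/-- [our object] **BOUNDED DEVIATION + BOUNDED LOG DEFECT ⇒ VALUE**, `m`-indexed: `|g m − m·g 1| ≤ D` and `|g m − m·v| ≤ C` for `m ≥ 1` give `g 1 = v`. -/
theorem value_eq_of_powdev_bounded' {g : ℕ → ℝ} {v C D : ℝ} (hdev : ∀ m : ℕ, 1 ≤ m → |g m - (m : ℝ) * g 1| ≤ D)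
    (hasym : ∀ m : ℕ, 1 ≤ m → |g m - (m : ℝ) * v| ≤ C) : g 1 = v := by
  refine eq_of_nat_mul_sub_bounded (C := max (C + D) 0) fun m => ?_
  rcases Nat.eq_zero_or_pos m with h0 | hpos
  · subst h0; simp
  · have h1 := hasym m hpos
    have h2 := hdev m hpos
    have e : (m : ℝ) * (g 1 - v) = (g m - (m : ℝ) * v) - (g m - (m : ℝ) * g 1) := by ring
    rw [e]
    exact ((abs_sub _ _).trans (by linarith [h1, h2])).trans (le_max_left _ _)

/-- [our object] A variable-defect step law `g (m+1) = g m + g 1 + δ m` with Σ-bounded defects gives the bounded deviation `|g m − m·g 1| ≤ D`, `m`-indexed. -/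
theorem powdev_of_summableDefect' {g δ : ℕ → ℝ} {D : ℝ} (hstep : ∀ m : ℕ, 1 ≤ m → g (m + 1) = g m + g 1 + δ m)
    (hsum : ∀ m : ℕ, 1 ≤ m → |∑ k ∈ Finset.Ico 1 m, δ k| ≤ D) (m : ℕ) (hm : 1 ≤ m) : |g m - (m : ℝ) * g 1| ≤ D := by
  rw [closed_form_of_variableDefect_step_law hstep m hm]
  have e : (m : ℝ) * g 1 + ∑ k ∈ Finset.Ico 1 m, δ k - (m : ℝ) * g 1 = ∑ k ∈ Finset.Ico 1 m, δ k := by ring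
  rw [e]
  exact hsum m hm

/-! ## §2 The dressing-agnostic END with the bounded-deviation binder -/

section End

variable {Lc : ℕ} [NeZero Lc] (Js : ℕ → JetData 3 Lc) (sf sm : ℕ → ℝ) (A G : ℕ → ℕ → MKer (3 + 1) (Fib 3))
  (S : ℕ → ℕ → Fin (3 + 1) → (Fin (3 + 1) → ℤ) → MKer (3 + 1) (Fib 3))
  (Wt : ℕ → ℕ → Fin (3 + 1) → (Fin (3 + 1) → ℤ) → Fin (3 + 1) → (Fin (3 + 1) → ℤ) → MKer (3 + 1) (Fib 3))
  {A1 G1 : ℕ → MKer (3 + 1) (Fib 3)} {S1 : ℕ → Fin (3 + 1) → (Fin (3 + 1) → ℤ) → MKer (3 + 1) (Fib 3)}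
  {W1 : ℕ → Fin (3 + 1) → (Fin (3 + 1) → ℤ) → Fin (3 + 1) → (Fin (3 + 1) → ℤ) → MKer (3 + 1) (Fib 3)}
  {R CA cA C cK δK Cs cS δS Cw cW δW θ : ℝ}

/-- **ROAD «FP», THE END BY TYPE, DRESSING-AGNOSTIC, BOUNDED-DEVIATION FORM** [our object].  Exactly `RoadEndGeneric.d1Drift_of_generic_step_law_bounded` with the STEP-LAW binder
replaced by `hdev : ∀ m ≥ 1, |fPerfG m − m·fPerfG 1| ≤ D` (door (ii) «GHOST-RG» of R-FP-47: Σ-bounded step defects).  Discharges nothing by itself. -/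
theorem d1Drift_of_generic_powdev_bounded (hsf : ∀ j, sf j ≠ 0) (hsm : ∀ j, sm j ≠ 0)
    (hT : ∀ j, TbalOf Lc Js j = hessKer (A1 j) (vertexOfK (G1 j) Lc (S1 j)) (W1 j))
    (hA1 : ∀ j, A j 1 = A1 j) (hG1 : ∀ j, G j 1 = G1 j) (hS1 : ∀ j, S j 1 = S1 j) (hW1 : ∀ j, Wt j 1 = W1 j)
    (hA : ∀ j, Decays (unitK (sf j) (sm j) (A1 j)) CA δK)
    (hAall : ∀ k j, Decays (unitK (sf (k + j)) (sm (k + j)) (A1 (k + j)) - unitK (sf k) (sm k) (A1 k)) (cA * θ ^ k) δK)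
    (hK : ∀ j, Decays (unitK (sf j) (sm j) (G1 j)) C δK)
    (hKall : ∀ k j, Decays (unitK (sf (k + j)) (sm (k + j)) (G1 (k + j)) - unitK (sf k) (sm k) (G1 k)) (cK * θ ^ k) δK)
    (hS : ∀ j, LocStencil (unitS (sf j) (sm j) (S1 j)) Cs δS)
    (hSall : ∀ k j, LocStencil (unitS (sf (k + j)) (sm (k + j)) (S1 (k + j)) - unitS (sf k) (sm k) (S1 k)) (cS * θ ^ k) δS)
    (hW : ∀ j, VertexFamily₂ (unitW (sf j) (sm j) (W1 j)) Lc Cw δW)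
    (hWall : ∀ k j, VertexFamily₂ (unitW (sf (k + j)) (sm (k + j)) (W1 (k + j)) - unitW (sf k) (sm k) (W1 k)) Lc (cW * θ ^ k) δW)
    (hR : 0 < R) (hRK : R < δK) (hRS : R / 2 < δS) (hRW : R < δW) (hθ0 : 0 ≤ θ) (hθ1 : θ < 1) (μ ν : Fin 4) {N Cg D : ℝ}
    (hdev : ∀ m : ℕ, 1 ≤ m →
      |fPerfG Lc sf sm A G S Wt μ ν m - (m : ℝ) * fPerfG Lc sf sm A G S Wt μ ν 1| ≤ D)
    (hasym : ∀ m : ℕ, 1 ≤ m → |fPerfG Lc sf sm A G S Wt μ ν m - (m : ℝ) * stepBal N Lc| ≤ Cg) :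
    D1Drift Lc Js N μ ν := by
  have h1 := value_eq_of_powdev_bounded' hdev hasym
  rw [fPerfG_one Lc sf sm A G S Wt μ ν hA1 hG1 hS1 hW1] at h1
  exact (d1Drift_iff_of_cauchy_four Js (closedForm_unit Js sf sm hsf hsm hT) hA hAall hK hKall hS hSall hW hWall hR hRK hRS hRW
    hθ0 hθ1 μ ν N).mpr h1

end End

section Self

variable {Lc : ℕ} [NeZero Lc] (Js : ℕ → JetData 3 Lc) (sf sm : ℕ → ℝ) (G : ℕ → ℕ → MKer (3 + 1) (Fib 3))
  (S : ℕ → ℕ → Fin (3 + 1) → (Fin (3 + 1) → ℤ) → MKer (3 + 1) (Fib 3))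
  (Wt : ℕ → ℕ → Fin (3 + 1) → (Fin (3 + 1) → ℤ) → Fin (3 + 1) → (Fin (3 + 1) → ℤ) → MKer (3 + 1) (Fib 3))
  {R C cK δK Cs cS δS Cw cW δW θ : ℝ}

/-- **ROAD «FP», THE END FOR ARBITRARY STEP JET DATA, BOUNDED-DEVIATION FORM** [our object] — `RoadEndGeneric.d1Drift_of_self_step_law_bounded` with `hstep ↦ hdev`. -/
theorem d1Drift_of_self_powdev_bounded (hsf : ∀ j, sf j ≠ 0) (hsm : ∀ j, sm j ≠ 0)
    (hG1 : ∀ j, G j 1 = KInvStep (d := 3) Lc j) (hS1 : ∀ j, S j 1 = (Js j).S) (hW1 : ∀ j, Wt j 1 = (Js j).W)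
    (hK : ∀ j, Decays (unitK (sf j) (sm j) (KInvStep (d := 3) Lc j)) C δK)
    (hKall : ∀ k j, Decays (unitK (sf (k + j)) (sm (k + j)) (KInvStep (d := 3) Lc (k + j)) -
      unitK (sf k) (sm k) (KInvStep (d := 3) Lc k)) (cK * θ ^ k) δK)
    (hS : ∀ j, LocStencil (unitS (sf j) (sm j) (Js j).S) Cs δS)
    (hSall : ∀ k j, LocStencil (unitS (sf (k + j)) (sm (k + j)) (Js (k + j)).S - unitS (sf k) (sm k) (Js k).S) (cS * θ ^ k) δS)
    (hW : ∀ j, VertexFamily₂ (unitW (sf j) (sm j) (Js j).W) Lc Cw δW)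
    (hWall : ∀ k j, VertexFamily₂ (unitW (sf (k + j)) (sm (k + j)) (Js (k + j)).W - unitW (sf k) (sm k) (Js k).W) Lc (cW * θ ^ k) δW)
    (hR : 0 < R) (hRK : R < δK) (hRS : R / 2 < δS) (hRW : R < δW) (hθ0 : 0 ≤ θ) (hθ1 : θ < 1) (μ ν : Fin 4) {N Cg D : ℝ}
    (hdev : ∀ m : ℕ, 1 ≤ m →
      |fPerfG Lc sf sm G G S Wt μ ν m - (m : ℝ) * fPerfG Lc sf sm G G S Wt μ ν 1| ≤ D)
    (hasym : ∀ m : ℕ, 1 ≤ m → |fPerfG Lc sf sm G G S Wt μ ν m - (m : ℝ) * stepBal N Lc| ≤ Cg) :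
    D1Drift Lc Js N μ ν :=
  d1Drift_of_generic_powdev_bounded Js sf sm G G S Wt (A1 := fun j => KInvStep (d := 3) Lc j) (G1 := fun j => KInvStep (d := 3) Lc j)
    (S1 := fun j => (Js j).S) (W1 := fun j => (Js j).W) hsf hsm (TbalOf_apply Js) hG1 hG1 hS1 hW1 hK hKall hK hKall hS hSall hW hWall
    hR hRK hRS hRW hθ0 hθ1 μ ν hdev hasym

/-- **ROAD «FP», THE END FOR ARBITRARY STEP JET DATA, SUMMABLE-DEFECT FORM** [our object]: the same with `hdev` supplied by a variable-defect step law whose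
defects have bounded partial sums (`powdev_of_summableDefect'`) — door (ii) «GHOST-RG» END-to-END at the dressing-agnostic level. -/
theorem d1Drift_of_self_summableDefect_bounded (hsf : ∀ j, sf j ≠ 0) (hsm : ∀ j, sm j ≠ 0)
    (hG1 : ∀ j, G j 1 = KInvStep (d := 3) Lc j) (hS1 : ∀ j, S j 1 = (Js j).S) (hW1 : ∀ j, Wt j 1 = (Js j).W)
    (hK : ∀ j, Decays (unitK (sf j) (sm j) (KInvStep (d := 3) Lc j)) C δK)
    (hKall : ∀ k j, Decays (unitK (sf (k + j)) (sm (k + j)) (KInvStep (d := 3) Lc (k + j)) -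
      unitK (sf k) (sm k) (KInvStep (d := 3) Lc k)) (cK * θ ^ k) δK)
    (hS : ∀ j, LocStencil (unitS (sf j) (sm j) (Js j).S) Cs δS)
    (hSall : ∀ k j, LocStencil (unitS (sf (k + j)) (sm (k + j)) (Js (k + j)).S - unitS (sf k) (sm k) (Js k).S) (cS * θ ^ k) δS)
    (hW : ∀ j, VertexFamily₂ (unitW (sf j) (sm j) (Js j).W) Lc Cw δW)
    (hWall : ∀ k j, VertexFamily₂ (unitW (sf (k + j)) (sm (k + j)) (Js (k + j)).W - unitW (sf k) (sm k) (Js k).W) Lc (cW * θ ^ k) δW)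
    (hR : 0 < R) (hRK : R < δK) (hRS : R / 2 < δS) (hRW : R < δW) (hθ0 : 0 ≤ θ) (hθ1 : θ < 1) (μ ν : Fin 4) {N Cg D : ℝ} {δ : ℕ → ℝ}
    (hstep : ∀ m : ℕ, 1 ≤ m →
      fPerfG Lc sf sm G G S Wt μ ν (m + 1) = fPerfG Lc sf sm G G S Wt μ ν m + fPerfG Lc sf sm G G S Wt μ ν 1 + δ m)
    (hsum : ∀ m : ℕ, 1 ≤ m → |∑ k ∈ Finset.Ico 1 m, δ k| ≤ D)
    (hasym : ∀ m : ℕ, 1 ≤ m → |fPerfG Lc sf sm G G S Wt μ ν m - (m : ℝ) * stepBal N Lc| ≤ Cg) :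
    D1Drift Lc Js N μ ν :=
  d1Drift_of_self_powdev_bounded Js sf sm G S Wt hsf hsm hG1 hS1 hW1 hK hKall hS hSall hW hWall hR hRK hRS hRW hθ0 hθ1 μ ν
    (powdev_of_summableDefect' (g := fun m => fPerfG Lc sf sm G G S Wt μ ν m) hstep hsum) hasym

end Self

end Summit.QuantumFields.BalabanUV.Beta.FP.RoadEndPowdev

end
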